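import Mathlib
import HarnessLib
import Summits.RiemannHypothesis.RiemannHypothesis.Theorems.IntegerScrewHarmonicKappa

/-!
# Route `IntegerScrew` — the brackets of the exact decomposition 16.4: signs and sizes
# (CONTINUUM-LIMIT 16.5 (b)–(f) pointwise, and 22.2 (i): `I(u,ρ) ≤ 0`)

THEOREM C♯ (PIVOT-LAW 13.44 / CONTINUUM-LIMIT §16) bounds `(𝒜_D − ∂_u)h̃` through the exact decomposition 16.4
(`IntegerScrewBirthIdentity.generator_sub_deriv_eq`): `births + deaths − ∂_u h̃ = Π·Σ_{q,a}(log q/(q^aL))·[bracket] − I(u,ρ)Π`,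
whose brackets are built from the three elementary expressions

* `F(θ) := K(u,ρ−θ)(1 − e^{−uθ}) − K(u,ρ)` (new prime `q ∤ x`, `θ = aθ_q`, with `φ(θ_q) ≤ φ(aθ_q)`),
* `K(u,ρ−θ) − K(u,ρ)` (repeat birth of a present prime, `B_rep`),
* `K(u,ρ) − K(u,ρ+θ)` (deaths, `N_death`, 16.5 (f)),

plus the weight factor `K(u,ρ−θ)φ/(q−1)` of `N_birth`.  CONTINUUM-LIMIT 16.5 (b)–(f) bounds each POINTWISE in terms of
`K := K(u,ρ)`, `K(u,0)` and `|c(u)|` before any prime is summed; this file is that pointwise layer, as inequalities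
between the explicit functions of `IntegerScrewHarmonicKDefs` (no primes, no walk):

* monotonicity and range of `F`: `F(0) = −K`; `F` is non-decreasing in `θ` on `[0, ρ]`; `−K ≤ F(θ) ≤ K(u,0) − K`;
  hence `|F(θ)| ≤ K(u,0) ≤ 2K(u,ρ)` for `ρ ≤ 1` (with `IntegerScrewHarmonicKappa`'s `κ₀ ≤ 2`);
* 16.5 (b): `−F(θ) ≤ K·e^{−uθ}` and `F(θ) ≤ K(u,ρ−θ) − K ≤ uθ|c(u)|`;
* 16.5 (c)/(d): `−K ≤ K(u,ρ−θ)φ(θ′) − K ≤ uθ|c|` (`0 ≤ θ′`), `0 ≤ K(u,ρ−θ) − K ≤ uθ|c|`;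
* 16.5 (e): `0 ≤ K(u,ρ−θ)φ(θ′) ≤ K(u,0)` for `θ ≤ ρ`;
* 16.5 (f): `0 ≤ K − K(u,ρ+θ) ≤ min(1, uθ)·|c|`;
* 22.2 (i): `I(u,ρ) = −(A+c)(1−e^{−uρ})/u + 2cρe^{−uρ}` with `A + c = (u − 2 + (u+2)e^{−u})/u² ≥ 0`, hence
  **`I(u,ρ) ≤ 0` for `u > 0`, `ρ ≥ 0`** (the Lebesgue part of `E_Mert` has a sign).

Calculus on `exp` only; RH-free and walk-free.  Nothing in this file bears on the truth of RH.
References: CONTINUUM-LIMIT §16.4–16.5, §21.1 (K2), §22.2; PIVOT-LAW 13.44/13.50; M. Suzuki, J. Lond. Math. Soc. (2) 108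
(2023) 1448–1487 [Suzuki2023] for the screw matrices this serves.
-/

noncomputable section

-- D-0017: `Summit.<S>.<S>.…` is the designed namespace of a single-problem summit.
set_option linter.dupNamespace false

namespace Summit.RiemannHypothesis.RiemannHypothesis.Theorems.IntegerScrew

open Real

/-! ## `φ(θ) = 1 − e^{−uθ}`: range and slope -/

/-- `0 ≤ 1 − e^{−uθ}` for `u, θ ≥ 0`. -/
theorem phi_nonneg {u θ : ℝ} (hu : 0 ≤ u) (hθ : 0 ≤ θ) : 0 ≤ 1 - exp (-(u * θ)) := by
  rw [sub_nonneg]; exact exp_le_one_iff.mpr (by nlinarith)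

/-- `1 − e^{−uθ} ≤ 1`. -/
theorem phi_le_one (u θ : ℝ) : 1 - exp (-(u * θ)) ≤ 1 := by
  linarith [exp_pos (-(u * θ))]

/-- `1 − e^{−uθ} ≤ uθ`. -/
theorem phi_le_mul (u θ : ℝ) : 1 - exp (-(u * θ)) ≤ u * θ := by
  linarith [add_one_le_exp (-(u * θ))]

/-- `φ` is non-decreasing: `1 − e^{−uθ₁} ≤ 1 − e^{−uθ₂}` for `u ≥ 0`, `θ₁ ≤ θ₂`. -/
theorem phi_mono {u θ₁ θ₂ : ℝ} (hu : 0 ≤ u) (h : θ₁ ≤ θ₂) :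
    1 - exp (-(u * θ₁)) ≤ 1 - exp (-(u * θ₂)) := by
  have : exp (-(u * θ₂)) ≤ exp (-(u * θ₁)) := exp_le_exp.mpr (by nlinarith)
  linarith

/-! ## `K(u,ρ−θ)`: monotone in `θ`, between `K(u,ρ)` and `K(u,0)` -/

/-- `K(u,ρ−θ₁) ≤ K(u,ρ−θ₂)` for `u > 0`, `θ₁ ≤ θ₂` (the room shrinks, `K` grows). -/
theorem ccpK_sub_mono {u : ℝ} (hu : 0 < u) (ρ : ℝ) {θ₁ θ₂ : ℝ} (h : θ₁ ≤ θ₂) :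
    ccpK u (ρ - θ₁) ≤ ccpK u (ρ - θ₂) := by
  have := ccpK_add_le hu (ρ - θ₂) (sub_nonneg.mpr h)
  rwa [show ρ - θ₂ + (θ₂ - θ₁) = ρ - θ₁ by ring] at this

/-- `K(u,ρ) ≤ K(u,ρ−θ)` for `u > 0`, `θ ≥ 0`. -/
theorem ccpK_le_ccpK_sub {u : ℝ} (hu : 0 < u) (ρ : ℝ) {θ : ℝ} (hθ : 0 ≤ θ) :
    ccpK u ρ ≤ ccpK u (ρ - θ) := by
  simpa using ccpK_sub_mono hu ρ hθ

/-- `K(u,ρ−θ) ≤ K(u,0)` for `u > 0`, `θ ≤ ρ` (non-negative room). -/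
theorem ccpK_sub_le_ccpK_zero {u : ℝ} (hu : 0 < u) {ρ θ : ℝ} (hθ : θ ≤ ρ) :
    ccpK u (ρ - θ) ≤ ccpK u 0 :=
  ccpK_le_ccpK_zero_of_nonneg hu (sub_nonneg.mpr hθ)

/-- `0 ≤ K(u,ρ−θ) − K(u,ρ) ≤ uθ|c(u)|` for `u > 0`, `0 ≤ θ ≤ ρ` — the `B_rep`/`B₂` bracket bound of 16.5 (c)–(d). -/
theorem ccpK_sub_sub_le {u : ℝ} (hu : 0 < u) {ρ θ : ℝ} (hθ : 0 ≤ θ) (hθρ : θ ≤ ρ) :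
    ccpK u (ρ - θ) - ccpK u ρ ≤ u * θ * |ccpc u| := by
  have h := ccpK_sub_ccpK_add_le hu (sub_nonneg.mpr hθρ) hθ
  rwa [sub_add_cancel] at h

/-- The sign half: `0 ≤ K(u,ρ−θ) − K(u,ρ)` (`u > 0`, `θ ≥ 0`). -/
theorem ccpK_sub_sub_nonneg {u : ℝ} (hu : 0 < u) (ρ : ℝ) {θ : ℝ} (hθ : 0 ≤ θ) :
    0 ≤ ccpK u (ρ - θ) - ccpK u ρ := by
  linarith [ccpK_le_ccpK_sub hu ρ hθ]

/-! ## `F(θ) = K(u,ρ−θ)φ(θ) − K(u,ρ)`: value at `0`, monotonicity, range (16.5 (a), (b)) -/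

/-- `F(0) = −K(u,ρ)`. -/
theorem bracketF_zero (u ρ : ℝ) : ccpK u (ρ - 0) * (1 - exp (-(u * 0))) - ccpK u ρ = -ccpK u ρ := by
  simp

/-- `F` is non-decreasing in `θ` on `[0, ∞)` (`u > 0`): both factors `K(u,ρ−θ)` and `φ(θ)` are non-negative
and non-decreasing. -/
theorem bracketF_mono {u : ℝ} (hu : 0 < u) (ρ : ℝ) {θ₁ θ₂ : ℝ} (h0 : 0 ≤ θ₁) (h : θ₁ ≤ θ₂) :
    ccpK u (ρ - θ₁) * (1 - exp (-(u * θ₁))) - ccpK u ρ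
      ≤ ccpK u (ρ - θ₂) * (1 - exp (-(u * θ₂))) - ccpK u ρ := by
  have hK := ccpK_sub_mono hu ρ h
  have hφ := phi_mono hu.le h
  have hK0 := (ccpK_pos hu (ρ - θ₁)).le
  have hφ0 := phi_nonneg hu.le (h0.trans h)
  have hφ1 := phi_nonneg hu.le h0
  have hK2 := (ccpK_pos hu (ρ - θ₂)).le
  nlinarith [mul_le_mul hK hφ hφ1 hK2]

/-- `−K(u,ρ) ≤ F(θ)` for `u > 0`, `θ ≥ 0`. -/
theorem neg_ccpK_le_bracketF {u : ℝ} (hu : 0 < u) (ρ : ℝ) {θ : ℝ} (hθ : 0 ≤ θ) :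
    -ccpK u ρ ≤ ccpK u (ρ - θ) * (1 - exp (-(u * θ))) - ccpK u ρ := by
  have := mul_nonneg (ccpK_pos hu (ρ - θ)).le (phi_nonneg hu.le hθ)
  linarith

/-- `F(θ) ≤ K(u,ρ−θ) − K(u,ρ)` (`φ ≤ 1`). -/
theorem bracketF_le_sub {u : ℝ} (hu : 0 < u) (ρ θ : ℝ) :
    ccpK u (ρ - θ) * (1 - exp (-(u * θ))) - ccpK u ρ ≤ ccpK u (ρ - θ) - ccpK u ρ := by
  have hK := (ccpK_pos hu (ρ - θ)).le
  have := mul_le_of_le_one_right hK (phi_le_one u θ)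
  linarith

/-- **16.5 (b), upper**: `F(θ)⁺ ≤ K(u,ρ−θ) − K ≤ uθ|c(u)|` for `u > 0`, `0 ≤ θ ≤ ρ`. -/
theorem bracketF_le {u : ℝ} (hu : 0 < u) {ρ θ : ℝ} (hθ : 0 ≤ θ) (hθρ : θ ≤ ρ) :
    ccpK u (ρ - θ) * (1 - exp (-(u * θ))) - ccpK u ρ ≤ u * θ * |ccpc u| :=
  (bracketF_le_sub hu ρ θ).trans (ccpK_sub_sub_le hu hθ hθρ)

/-- **16.5 (b), lower**: `−F(θ) ≤ K(u,ρ)·e^{−uθ}` for `u > 0`, `θ ≥ 0` (`K(u,ρ−θ) ≥ K(u,ρ)`, so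
`K − K(u,ρ−θ)φ ≤ K − Kφ = Ke^{−uθ}`). -/
theorem neg_bracketF_le {u : ℝ} (hu : 0 < u) (ρ : ℝ) {θ : ℝ} (hθ : 0 ≤ θ) :
    -(ccpK u (ρ - θ) * (1 - exp (-(u * θ))) - ccpK u ρ) ≤ ccpK u ρ * exp (-(u * θ)) := by
  have hK := ccpK_le_ccpK_sub hu ρ hθ
  have hφ := phi_nonneg hu.le hθ
  have := mul_le_mul_of_nonneg_right hK hφ
  nlinarith

/-- Range, upper end: `F(θ) ≤ K(u,0) − K(u,ρ)` for `u > 0`, `0 ≤ θ ≤ ρ`; in particular `F(ρ) − F(0) ≤ K(u,0)`. -/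
theorem bracketF_le_ccpK_zero_sub {u : ℝ} (hu : 0 < u) {ρ θ : ℝ} (hθρ : θ ≤ ρ) :
    ccpK u (ρ - θ) * (1 - exp (-(u * θ))) - ccpK u ρ ≤ ccpK u 0 - ccpK u ρ := by
  have h1 := bracketF_le_sub hu ρ θ
  have h2 := ccpK_sub_le_ccpK_zero hu hθρ
  linarith

/-- `|F(θ)| ≤ K(u,0)` for `u > 0`, `0 ≤ θ ≤ ρ` (16.5 (a): `|F(ρ)| ≤ K(u,0)`). -/
theorem abs_bracketF_le {u : ℝ} (hu : 0 < u) {ρ θ : ℝ} (hθ : 0 ≤ θ) (hθρ : θ ≤ ρ) :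
    |ccpK u (ρ - θ) * (1 - exp (-(u * θ))) - ccpK u ρ| ≤ ccpK u 0 := by
  rw [abs_le]
  constructor
  · have h1 := neg_ccpK_le_bracketF hu ρ hθ
    have h2 := ccpK_le_ccpK_zero_of_nonneg hu (hθ.trans hθρ)
    linarith
  · have h1 := bracketF_le_ccpK_zero_sub hu hθρ
    linarith [ccpK_pos hu ρ]

/-- With `κ₀ ≤ 2`: `|F(θ)| ≤ 2K(u,ρ)` for `u > 0`, `0 ≤ θ ≤ ρ ≤ 1` — the form 16.5 (a) divides by. -/
theorem abs_bracketF_le_two_mul {u : ℝ} (hu : 0 < u) {ρ θ : ℝ} (hθ : 0 ≤ θ) (hθρ : θ ≤ ρ) (hρ : ρ ≤ 1) :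
    |ccpK u (ρ - θ) * (1 - exp (-(u * θ))) - ccpK u ρ| ≤ 2 * ccpK u ρ :=
  (abs_bracketF_le hu hθ hθρ).trans (ccpK_zero_le_two_mul_ccpK hu hρ)

/-! ## The `B₂` bracket with the prime's `φ(θ_q)` in place of `φ(aθ_q)` (16.5 (c)) and the `N_birth` weight (16.5 (e)) -/

/-- **16.5 (c)**: `−K ≤ K(u,ρ−θ)φ(θ′) − K ≤ uθ|c|` for `u > 0`, `0 ≤ θ′`, `0 ≤ θ ≤ ρ` (in 16.4, `θ = aθ_q`, `θ′ = θ_q`). -/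
theorem bracketB_bounds {u : ℝ} (hu : 0 < u) {ρ θ θ' : ℝ} (hθ : 0 ≤ θ) (hθρ : θ ≤ ρ) (hθ' : 0 ≤ θ') :
    -ccpK u ρ ≤ ccpK u (ρ - θ) * (1 - exp (-(u * θ'))) - ccpK u ρ ∧
      ccpK u (ρ - θ) * (1 - exp (-(u * θ'))) - ccpK u ρ ≤ u * θ * |ccpc u| := by
  have hK := (ccpK_pos hu (ρ - θ)).le
  constructor
  · have := mul_nonneg hK (phi_nonneg hu.le hθ')
    linarith
  · have h1 := mul_le_of_le_one_right hK (phi_le_one u θ')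
    have h2 := ccpK_sub_sub_le hu hθ hθρ
    linarith

/-- **16.5 (e)**: `0 ≤ K(u,ρ−θ)φ(θ′) ≤ K(u,0)` for `u > 0`, `θ ≤ ρ`, `θ′ ≥ 0` (the `N_birth` weight before `/(q−1)`). -/
theorem birthWeight_bounds {u : ℝ} (hu : 0 < u) {ρ θ θ' : ℝ} (hθρ : θ ≤ ρ) (hθ' : 0 ≤ θ') :
    0 ≤ ccpK u (ρ - θ) * (1 - exp (-(u * θ'))) ∧ ccpK u (ρ - θ) * (1 - exp (-(u * θ'))) ≤ ccpK u 0 := by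
  have hK := (ccpK_pos hu (ρ - θ)).le
  exact ⟨mul_nonneg hK (phi_nonneg hu.le hθ'),
    (mul_le_of_le_one_right hK (phi_le_one u θ')).trans (ccpK_sub_le_ccpK_zero hu hθρ)⟩

/-! ## Deaths: `0 ≤ K(u,ρ) − K(u,ρ+θ) ≤ min(1, uθ)|c|` (16.5 (f)) -/

/-- `K(u,ρ) − K(u,ρ+θ) = (1 − e^{−uθ})e^{−uρ}|c(u)|` (`u > 0`): (H1) with the sign of `c` made explicit. -/
theorem ccpK_sub_ccpK_add_eq {u : ℝ} (hu : 0 < u) (ρ θ : ℝ) :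
    ccpK u ρ - ccpK u (ρ + θ) = (1 - exp (-(u * θ))) * exp (-(u * ρ)) * |ccpc u| := by
  rw [abs_of_neg (ccpc_neg hu)]
  have := ccpK_add_sub hu.ne' ρ θ
  linarith

/-- **16.5 (f)**: `K(u,ρ) − K(u,ρ+θ) ≤ |c(u)|` for `u > 0`, `ρ, θ ≥ 0`. -/
theorem ccpK_sub_ccpK_add_le_abs {u : ℝ} (hu : 0 < u) {ρ θ : ℝ} (hρ : 0 ≤ ρ) (hθ : 0 ≤ θ) :
    ccpK u ρ - ccpK u (ρ + θ) ≤ |ccpc u| := by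
  rw [ccpK_sub_ccpK_add_eq hu]
  have h1 := phi_le_one u θ
  have h1' := phi_nonneg hu.le hθ
  have h2 : exp (-(u * ρ)) ≤ 1 := exp_le_one_iff.mpr (by nlinarith)
  have h2' := (exp_pos (-(u * ρ))).le
  have hc := abs_nonneg (ccpc u)
  calc (1 - exp (-(u * θ))) * exp (-(u * ρ)) * |ccpc u| ≤ 1 * 1 * |ccpc u| := by gcongr
    _ = |ccpc u| := by ring

/-- **16.5 (f)**: `K(u,ρ) − K(u,ρ+θ) ≤ uθ|c(u)|` for `u > 0`, `ρ, θ ≥ 0`. -/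
theorem ccpK_sub_ccpK_add_le_mul {u : ℝ} (hu : 0 < u) {ρ θ : ℝ} (hρ : 0 ≤ ρ) (hθ : 0 ≤ θ) :
    ccpK u ρ - ccpK u (ρ + θ) ≤ u * θ * |ccpc u| :=
  ccpK_sub_ccpK_add_le hu hρ hθ

/-! ## 22.2 (i): `I(u,ρ) ≤ 0` -/

/-- `I(u,ρ) = −(A(u) + c(u))(1 − e^{−uρ})/u + 2c(u)ρe^{−uρ}` (`u ≠ 0`; CONTINUUM-LIMIT 21.1 (K2)). -/
theorem ccpI_eq {u : ℝ} (hu : u ≠ 0) (ρ : ℝ) :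
    ccpI u ρ = -(ccpA u + ccpc u) * (1 - exp (-(u * ρ))) / u + 2 * ccpc u * ρ * exp (-(u * ρ)) := by
  unfold ccpI ccpA ccpc
  field_simp
  ring

/-- `A(u) + c(u) = (u − 2 + (u+2)e^{−u})/u² ≥ 0` for `u > 0` (`IntegerScrewHarmonicKappa.padeDefect_nonneg`). -/
theorem ccpA_add_ccpc_nonneg {u : ℝ} (hu : 0 < u) : 0 ≤ ccpA u + ccpc u := by
  have h := padeDefect_nonneg hu.le
  have e : ccpA u + ccpc u = (u - 2 + u * exp (-u) + 2 * exp (-u)) / u ^ 2 := by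
    unfold ccpA ccpc; field_simp; ring
  rw [e]
  positivity

/-- **`I(u,ρ) ≤ 0` for `u > 0`, `ρ ≥ 0`** (CONTINUUM-LIMIT 22.2 (i)): the Lebesgue integral `∫₀^ρ F` of the
`E_Mert` bracket is non-positive — at states with no possible birth, `(𝒜_D − ∂_u)h̃ = −I·Π ≥ 0`. -/
theorem ccpI_nonpos {u : ℝ} (hu : 0 < u) {ρ : ℝ} (hρ : 0 ≤ ρ) : ccpI u ρ ≤ 0 := by
  rw [ccpI_eq hu.ne']
  have h1 := ccpA_add_ccpc_nonneg hu
  have h2 : 0 ≤ 1 - exp (-(u * ρ)) := phi_nonneg hu.le hρ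
  have h3 := (ccpc_neg hu).le
  have h4 := (exp_pos (-(u * ρ))).le
  have t1 : -(ccpA u + ccpc u) * (1 - exp (-(u * ρ))) / u ≤ 0 :=
    div_nonpos_of_nonpos_of_nonneg (by nlinarith) hu.le
  have t2 : 2 * ccpc u * ρ * exp (-(u * ρ)) ≤ 0 := by
    have : 0 ≤ ρ * exp (-(u * ρ)) := mul_nonneg hρ h4
    nlinarith
  linarith

end Summit.RiemannHypothesis.RiemannHypothesis.Theorems.IntegerScrew

end
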